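import Summits.QuantumFields.YangMills.Theorems.AllWindowsColdBoxBoxKernelSizeDecay

/-!
# TASK T-S5/U5.4f «FP operator floor»: `DirichletGreenRowSum` (4f-i) and `NeumannRowInverse` (4f-ii), typed verbatim from the
# planner's text and PROVED

Planner ym-idea-2 g17, bus `ym-idea-2/INBOX.md` 2026-08-29T17:04:37Z (T-S5.4 bricks, 4f), for the XL comparison stubs S5 (LINE-19
⟨stmt-QuantumFields-24004⟩/⟨24335⟩) and U5 (LINE-20 ⟨24336⟩): the Faddeev–Popov operator of step (1b) is
`fpOperator H U = boxLap ⊗ 1₃ + E(U)` with `boxLap (2H) univ` the interior Dirichlet Laplacian of the J′ engine (✓`…BoxKernelGreen`) and a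
perturbation of row-ℓ¹ size `≤ C·r₀`; 4f supplies the two facts that make it invertible with inverse row-sums `≤ 2C H²` in every window:

* (4f-i) **`DirichletGreenRowSum`**: `Σ_t |(boxLap (2H) univ)⁻¹ s t| ≤ C·H²`.  From ✓`boxLap_inv_size_decay`
  (`|G(s,t)|·(1 + |s_κ − t_κ|)² ≤ C₀` for EVERY coordinate `κ`): taking the geometric mean over the four coordinates,
  `|G(s,t)| ≤ C₀ ∏_κ (1 + |s_κ − t_κ|)^{-1/2}` (`le_mul_prod_of_forall_le_mul_pow_four`), the sum over the box is bounded by the sum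
  over all of `(Fin (2H))⁴`, which FACTORISES (`Fintype.prod_sum`) into four one-dimensional sums `Σ_m (1 + |a − m|)^{-1/2} ≤ 4√(2H)`
  (`sum_inv_sqrt_dist_le`, from the telescoping `Σ_{j<n} (1+j)^{-1/2} ≤ 2√n`, `sum_inv_sqrt_le`); so `C = 1024·C₀`.
* (4f-ii) **`NeumannRowInverse`**: if `A G = 1`, the rows of `G` have ℓ¹-norm `≤ g`, those of `E` have ℓ¹-norm `≤ ε`, and `εg ≤ ½`, then
  `A + E` has a right inverse with row-sums `≤ 2g`.  Finite-dimensional, norm-free proof: `M := G E` has row-sums `≤ gε ≤ ½`, so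
  `1 + M` is strictly diagonally dominant, hence invertible (Mathlib's Gershgorin `det_ne_zero_of_sum_row_lt_diag`); its inverse `B`
  satisfies `B = 1 − B M`, so each row-sum `r_i` of `B` obeys `r_i ≤ 1 + r_i/2`, i.e. `r_i ≤ 2`; and `G' := B G` works because
  `A + E = A (1 + G E)`.

Mathlib + tree only; the only definitions are the two task Props (verbatim); standard axioms.  HONEST LABEL: elementary bricks of step (1b)
of the XL stubs S5/U5; T-S5.4 proper, S5, U5 and the cruxes ⟨24004⟩ ⟨24335⟩ ⟨24336⟩ remain OPEN; no summit is proved; the Yang–Mills mass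
gap is NOT proved by this file.  Seat ym-line-sfw-p2-w5 g21 (cell ym-idea-1).
-/

set_option autoImplicit false

noncomputable section

open Matrix Finset
open Summit.QuantumFields.YangMills.Theorems.AllWindowsColdBox.BoxKernel (Box boxLap boxLap_inv_size_decay)

namespace Summit.QuantumFields.YangMills.Theorems.AllWindowsColdBoxBoxHighLine

/-! ## The task's Props (verbatim from the planner's text) -/

/-- T-S5.4f-i **(row sums of the interior Dirichlet Green's function; S–M)**: `Σ_t |(boxLap (2H) univ)⁻¹ s t| ≤ C·H²`. -/
def DirichletGreenRowSum : Prop :=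
  ∃ C : ℝ, ∀ H : ℕ, 1 ≤ H → ∀ s : Box 4 (2*H) Finset.univ,
    ∑ t, |(boxLap (2*H) (Finset.univ : Finset (Fin 4)))⁻¹ s t| ≤ C * (H:ℝ)^2

/-- T-S5.4f-ii **(Neumann-series right inverse with row-ℓ¹ control; S)**. -/
def NeumannRowInverse : Prop :=
  ∀ (ι : Type) [Fintype ι] [DecidableEq ι] (A G E : Matrix ι ι ℝ) (g ε : ℝ), A * G = 1 →
    (∀ i, ∑ j, |G i j| ≤ g) → (∀ i, ∑ j, |E i j| ≤ ε) → ε * g ≤ 1/2 →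
      ∃ G' : Matrix ι ι ℝ, (A + E) * G' = 1 ∧ ∀ i, ∑ j, |G' i j| ≤ 2 * g

namespace FPOperatorFloor

/-! ## One-dimensional sums `Σ (1 + j)^{-1/2}` -/

/-- `Σ_{j<n} 1/√(1+j) ≤ 2√n` (telescoping: `1/√(n+1) ≤ 2(√(n+1) − √n)`). -/
theorem sum_inv_sqrt_le (n : ℕ) : ∑ j ∈ Finset.range n, 1 / Real.sqrt (1 + j) ≤ 2 * Real.sqrt n := by
  induction n with
  | zero => simp
  | succ n ih =>
    rw [Finset.sum_range_succ]
    have hy : 0 < Real.sqrt (1 + n) := Real.sqrt_pos.2 (by positivity)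
    have hx2 : Real.sqrt n ^ 2 = n := Real.sq_sqrt (by positivity)
    have hy2 : Real.sqrt (1 + n) ^ 2 = 1 + n := Real.sq_sqrt (by positivity)
    have hcast : Real.sqrt ((n + 1 : ℕ) : ℝ) = Real.sqrt (1 + n) := by push_cast; rw [add_comm]
    rw [hcast]
    have key : 2 * Real.sqrt (1 + n) - 2 * Real.sqrt n - 1 / Real.sqrt (1 + n) =
        (Real.sqrt n - Real.sqrt (1 + n)) ^ 2 / Real.sqrt (1 + n) := by
      field_simp
      nlinarith [hx2, hy2]
    have hnn : 0 ≤ (Real.sqrt n - Real.sqrt (1 + n)) ^ 2 / Real.sqrt (1 + n) := by positivity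
    linarith

/-- The shifted sum `Σ_{j<n} 1/√(2+j) ≤ 2√n`. -/
theorem sum_inv_sqrt_succ_le (n : ℕ) : ∑ j ∈ Finset.range n, 1 / Real.sqrt (1 + ((j + 1 : ℕ) : ℝ)) ≤ 2 * Real.sqrt n := by
  refine (Finset.sum_le_sum fun j _ => ?_).trans (sum_inv_sqrt_le n)
  push_cast
  exact one_div_le_one_div_of_le (Real.sqrt_pos.2 (by positivity)) (Real.sqrt_le_sqrt (by linarith))

/-- For `m ≤ a`: `|a − m| = a − m` read through the casts. -/
theorem abs_natCast_sub_of_le {a m : ℕ} (h : m ≤ a) : |(a : ℝ) - m| = ((a - m : ℕ) : ℝ) := by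
  rw [Nat.cast_sub h, abs_of_nonneg (by rw [sub_nonneg]; exact_mod_cast h)]

/-- For `a ≤ m`: `|a − m| = m − a` read through the casts. -/
theorem abs_natCast_sub_of_ge {a m : ℕ} (h : a ≤ m) : |(a : ℝ) - m| = ((m - a : ℕ) : ℝ) := by
  rw [abs_sub_comm, Nat.cast_sub h, abs_of_nonneg (by rw [sub_nonneg]; exact_mod_cast h)]

/-- `Σ_{m<N} 1/√(1 + |a − m|) ≤ 4√N` for `a < N` (split at `m = a` into two one-sided sums, each `≤ 2√N`). -/
theorem sum_inv_sqrt_dist_le {N a : ℕ} (ha : a < N) :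
    ∑ m ∈ Finset.range N, 1 / Real.sqrt (1 + |(a : ℝ) - m|) ≤ 4 * Real.sqrt N := by
  have hsN : ∀ k : ℕ, k ≤ N → 2 * Real.sqrt k ≤ 2 * Real.sqrt N := fun k hk =>
    mul_le_mul_of_nonneg_left (Real.sqrt_le_sqrt (by exact_mod_cast hk)) (by norm_num)
  -- split `range N = range a ∪ Ico a N`
  rw [← Finset.sum_range_add_sum_Ico _ ha.le]
  -- the part `m < a`: reflect `m ↦ a − 1 − m`
  have h1 : ∑ m ∈ Finset.range a, 1 / Real.sqrt (1 + |(a : ℝ) - m|) ≤ 2 * Real.sqrt N := by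
    have hre : ∑ m ∈ Finset.range a, 1 / Real.sqrt (1 + |(a : ℝ) - m|) =
        ∑ j ∈ Finset.range a, 1 / Real.sqrt (1 + ((j + 1 : ℕ) : ℝ)) := by
      rw [← Finset.sum_range_reflect (fun m => 1 / Real.sqrt (1 + |(a : ℝ) - m|)) a]
      refine Finset.sum_congr rfl fun j hj => ?_
      have hj' := Finset.mem_range.1 hj
      rw [abs_natCast_sub_of_le (by omega)]
      congr 4
      omega
    rw [hre]
    exact (sum_inv_sqrt_succ_le a).trans (hsN a ha.le)
  -- the part `a ≤ m`: shift `m = a + k`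
  have h2 : ∑ m ∈ Finset.Ico a N, 1 / Real.sqrt (1 + |(a : ℝ) - m|) ≤ 2 * Real.sqrt N := by
    rw [Finset.sum_Ico_eq_sum_range]
    have hre : ∑ k ∈ Finset.range (N - a), 1 / Real.sqrt (1 + |(a : ℝ) - ((a + k : ℕ) : ℝ)|) =
        ∑ k ∈ Finset.range (N - a), 1 / Real.sqrt (1 + k) := by
      refine Finset.sum_congr rfl fun k _ => ?_
      rw [abs_natCast_sub_of_ge (by omega), Nat.add_sub_cancel_left]
    rw [hre]
    exact (sum_inv_sqrt_le (N - a)).trans (hsN (N - a) (by omega))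
  linarith

/-! ## The geometric mean of the four coordinate bounds -/

/-- If `x ≤ C b_κ⁴` for each of four nonnegative `b_κ`, then `x ≤ C ∏_κ b_κ`. -/
theorem le_mul_prod_of_forall_le_mul_pow_four {x C : ℝ} {b : Fin 4 → ℝ} (hx : 0 ≤ x) (hC : 0 ≤ C) (hb : ∀ κ, 0 ≤ b κ)
    (h : ∀ κ, x ≤ C * b κ ^ 4) : x ≤ C * ∏ κ, b κ := by
  have h4 : x ^ 4 ≤ (C * ∏ κ, b κ) ^ 4 := by
    calc x ^ 4 = ∏ _κ : Fin 4, x := by rw [Finset.prod_const, Finset.card_univ, Fintype.card_fin]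
      _ ≤ ∏ κ, C * b κ ^ 4 := Finset.prod_le_prod (fun _ _ => hx) (fun κ _ => h κ)
      _ = (C * ∏ κ, b κ) ^ 4 := by
          rw [Finset.prod_mul_distrib, Finset.prod_const, Finset.card_univ, Fintype.card_fin, Finset.prod_pow, mul_pow]
  exact (pow_le_pow_iff_left₀ hx (mul_nonneg hC (Finset.prod_nonneg fun κ _ => hb κ)) (by norm_num)).1 h4

/-! ## Row sums of matrix products -/

/-- Row-ℓ¹ norm of a product: `Σ_j |(B M)_{ij}| ≤ (Σ_k |B_{ik}|) · max_k Σ_j |M_{kj}|`. -/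
theorem rowsum_mul_le {ι κ' : Type} [Fintype ι] [Fintype κ'] (B : Matrix κ' ι ℝ) (M : Matrix ι ι ℝ) {m : ℝ}
    (hM : ∀ k, ∑ j, |M k j| ≤ m) (i : κ') : ∑ j, |(B * M) i j| ≤ (∑ k, |B i k|) * m := by
  calc ∑ j, |(B * M) i j| = ∑ j, |∑ k, B i k * M k j| := by simp only [Matrix.mul_apply]
    _ ≤ ∑ j, ∑ k, |B i k| * |M k j| :=
        Finset.sum_le_sum fun j _ => (Finset.abs_sum_le_sum_abs _ _).trans (le_of_eq (by simp_rw [abs_mul]))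
    _ = ∑ k, |B i k| * ∑ j, |M k j| := by rw [Finset.sum_comm]; simp_rw [Finset.mul_sum]
    _ ≤ ∑ k, |B i k| * m := Finset.sum_le_sum fun k _ => mul_le_mul_of_nonneg_left (hM k) (abs_nonneg _)
    _ = (∑ k, |B i k|) * m := by rw [Finset.sum_mul]

end FPOperatorFloor

open FPOperatorFloor

/-! ## T-S5.4f-i -/

/-- **T-S5.4f-i: row sums of the interior Dirichlet Green's function are `O(H²)`** (constant `1024·C₀`, `C₀` the constant of
✓`boxLap_inv_size_decay`). -/
theorem dirichletGreenRowSum : DirichletGreenRowSum := by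
  classical
  obtain ⟨C₀, hC₀, hdec⟩ := boxLap_inv_size_decay
  refine ⟨1024 * C₀, fun H hH s => ?_⟩
  haveI : NeZero (2 * H) := ⟨by omega⟩
  -- the coordinate weights `(1 + |s_κ − m|)^{-1/2}`
  set w : Fin 4 → Fin (2 * H) → ℝ := fun κ m => 1 / Real.sqrt (1 + |((s.1 κ : ℕ) : ℝ) - ((m : ℕ) : ℝ)|) with hw
  have hw_pos : ∀ κ m, 0 < w κ m := fun κ m => by simp only [hw]; positivity
  have hsq4 : ∀ x : ℝ, 0 ≤ x → (1 / Real.sqrt x) ^ 4 = 1 / x ^ 2 := fun x hx => by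
    rw [_root_.one_div_pow, show Real.sqrt x ^ 4 = (Real.sqrt x ^ 2) ^ 2 by ring, Real.sq_sqrt hx]
  have hw4 : ∀ κ m, (w κ m) ^ 4 = 1 / (1 + |((s.1 κ : ℕ) : ℝ) - ((m : ℕ) : ℝ)|) ^ 2 := by
    intro κ m
    simp only [hw]
    exact hsq4 _ (by positivity)
  -- pointwise: `|G s t| ≤ C₀ ∏_κ w κ (t κ)`
  have hpt : ∀ t : Box 4 (2 * H) Finset.univ,
      |(boxLap (2 * H) (Finset.univ : Finset (Fin 4)))⁻¹ s t| ≤ C₀ * ∏ κ, w κ (t.1 κ) := by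
    intro t
    refine le_mul_prod_of_forall_le_mul_pow_four (abs_nonneg _) hC₀ (fun κ => (hw_pos κ (t.1 κ)).le) fun κ => ?_
    rw [hw4, mul_one_div, le_div_iff₀ (by positivity)]
    exact hdec (2 * H) Finset.univ Finset.univ_nonempty κ s t
  -- one-dimensional sums
  have h1d : ∀ κ, ∑ m : Fin (2 * H), w κ m ≤ 4 * Real.sqrt ((2 * H : ℕ) : ℝ) := by
    intro κ
    rw [Fin.sum_univ_eq_sum_range (fun m => 1 / Real.sqrt (1 + |((s.1 κ : ℕ) : ℝ) - ((m : ℕ) : ℝ)|)) (2 * H)]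
    exact sum_inv_sqrt_dist_le (s.1 κ).isLt
  -- sum over the box ≤ sum over the whole grid, which factorises
  have hsub : ∑ t : Box 4 (2 * H) Finset.univ, C₀ * ∏ κ, w κ (t.1 κ) ≤ ∑ t : Fin 4 → Fin (2 * H), C₀ * ∏ κ, w κ (t κ) := by
    rw [← Finset.sum_subtype (Finset.univ.filter fun t : Fin 4 → Fin (2 * H) => ∀ ν ∈ (Finset.univ : Finset (Fin 4)), (t ν : ℕ) ≠ 0)
      (by simp) (fun t : Fin 4 → Fin (2 * H) => C₀ * ∏ κ, w κ (t κ))]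
    exact Finset.sum_le_univ_sum_of_nonneg fun t => mul_nonneg hC₀ (Finset.prod_nonneg fun κ _ => (hw_pos κ (t κ)).le)
  have hsqrt : Real.sqrt ((2 * H : ℕ) : ℝ) ^ 4 = 4 * (H : ℝ) ^ 2 := by
    rw [show Real.sqrt ((2 * H : ℕ) : ℝ) ^ 4 = (Real.sqrt ((2 * H : ℕ) : ℝ) ^ 2) ^ 2 by ring, Real.sq_sqrt (by positivity)]
    push_cast; ring
  calc ∑ t, |(boxLap (2 * H) (Finset.univ : Finset (Fin 4)))⁻¹ s t|
      ≤ ∑ t : Box 4 (2 * H) Finset.univ, C₀ * ∏ κ, w κ (t.1 κ) := Finset.sum_le_sum fun t _ => hpt t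
    _ ≤ ∑ t : Fin 4 → Fin (2 * H), C₀ * ∏ κ, w κ (t κ) := hsub
    _ = C₀ * ∏ κ : Fin 4, ∑ m : Fin (2 * H), w κ m := by rw [← Finset.mul_sum, Fintype.prod_sum]
    _ ≤ C₀ * ∏ _κ : Fin 4, (4 * Real.sqrt ((2 * H : ℕ) : ℝ)) := by
        refine mul_le_mul_of_nonneg_left (Finset.prod_le_prod (fun κ _ => Finset.sum_nonneg fun m _ => (hw_pos κ m).le)
          fun κ _ => h1d κ) hC₀
    _ = 1024 * C₀ * (H : ℝ) ^ 2 := by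
        rw [Finset.prod_const, Finset.card_univ, Fintype.card_fin, mul_pow, hsqrt]; ring

/-! ## T-S5.4f-ii -/

/-- **T-S5.4f-ii: Neumann right inverse with row-ℓ¹ control** (finite-dimensional: strict diagonal dominance of `1 + G E` and the
identity `B = 1 − B·(G E)` for its inverse `B`; `G' = B G`). -/
theorem neumannRowInverse : NeumannRowInverse := by
  intro ι _ _ A G E g ε hAG hG hE hεg
  rcases isEmpty_or_nonempty ι with hι | hι
  · exact ⟨0, Subsingleton.elim _ _, fun i => (IsEmpty.false i).elim⟩
  obtain ⟨i₀⟩ := hι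
  have hg0 : 0 ≤ g := (Finset.sum_nonneg fun j _ => abs_nonneg (G i₀ j)).trans (hG i₀)
  have hε0 : 0 ≤ ε := (Finset.sum_nonneg fun j _ => abs_nonneg (E i₀ j)).trans (hE i₀)
  set M : Matrix ι ι ℝ := G * E with hM
  have hMrow : ∀ k, ∑ j, |M k j| ≤ 1 / 2 := fun k =>
    (rowsum_mul_le G E hE k).trans (((mul_le_mul_of_nonneg_right (hG k) hε0)).trans (by rw [mul_comm]; exact hεg))
  -- `1 + M` is strictly diagonally dominant, hence invertible
  have hdet : (1 + M).det ≠ 0 := by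
    apply det_ne_zero_of_sum_row_lt_diag
    intro k
    have hsplit : ∑ j ∈ Finset.univ.erase k, ‖(1 + M) k j‖ = ∑ j ∈ Finset.univ.erase k, |M k j| := by
      refine Finset.sum_congr rfl fun j hj => ?_
      rw [Real.norm_eq_abs, Matrix.add_apply, Matrix.one_apply_ne (Finset.ne_of_mem_erase hj).symm, zero_add]
    have hsum : ∑ j ∈ Finset.univ.erase k, |M k j| = ∑ j, |M k j| - |M k k| := by
      rw [Finset.sum_erase_eq_sub (Finset.mem_univ k)]
    have hkk : 1 - |M k k| ≤ ‖(1 + M) k k‖ := by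
      rw [Real.norm_eq_abs, Matrix.add_apply, Matrix.one_apply_eq]
      have := abs_add_le (1 + M k k) (-(M k k))
      rw [add_neg_cancel_right, abs_one, abs_neg] at this
      linarith
    rw [hsplit, hsum]
    linarith [hMrow k, abs_nonneg (M k k)]
  have hunit : IsUnit (1 + M).det := isUnit_iff_ne_zero.2 hdet
  set B : Matrix ι ι ℝ := (1 + M)⁻¹ with hB
  have hB1 : (1 + M) * B = 1 := Matrix.mul_nonsing_inv _ hunit
  have hB2 : B * (1 + M) = 1 := Matrix.nonsing_inv_mul _ hunit
  -- row sums of `B` are at most `2`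
  have hBrow : ∀ i, ∑ j, |B i j| ≤ 2 := by
    intro i
    have hBeq : B = 1 - B * M := by
      rw [Matrix.mul_add, Matrix.mul_one] at hB2
      rw [← hB2, add_sub_cancel_right]
    have hone : ∑ j, |(1 : Matrix ι ι ℝ) i j| = 1 := by
      have habs : ∀ j, |(1 : Matrix ι ι ℝ) i j| = (1 : Matrix ι ι ℝ) i j := fun j =>
        abs_of_nonneg (by rw [Matrix.one_apply]; split_ifs <;> norm_num)
      simp_rw [habs, Matrix.one_apply]
      simp
    have h1 : ∑ j, |B i j| ≤ ∑ j, |(1 : Matrix ι ι ℝ) i j| + ∑ j, |(B * M) i j| := by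
      rw [← Finset.sum_add_distrib]
      refine Finset.sum_le_sum fun j _ => ?_
      conv_lhs => rw [hBeq]
      rw [Matrix.sub_apply]
      exact abs_sub _ _
    have h3 : ∑ j, |(B * M) i j| ≤ (∑ k, |B i k|) * (1 / 2) := rowsum_mul_le B M hMrow i
    linarith
  refine ⟨B * G, ?_, fun i => ?_⟩
  · have hAE : A + E = A * (1 + M) := by
      rw [Matrix.mul_add, Matrix.mul_one, hM, ← Matrix.mul_assoc, hAG, Matrix.one_mul]
    rw [hAE, Matrix.mul_assoc, ← Matrix.mul_assoc (1 + M), hB1, Matrix.one_mul, hAG]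
  · calc ∑ j, |(B * G) i j| ≤ (∑ k, |B i k|) * g := rowsum_mul_le B G hG i
      _ ≤ 2 * g := mul_le_mul_of_nonneg_right (hBrow i) hg0

end Summit.QuantumFields.YangMills.Theorems.AllWindowsColdBoxBoxHighLine

end
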